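import Summits.QuantumFields.YangMills.Theorems.BalabanUVNodesN15KingModelBoxBoundaryRate
import Summits.QuantumFields.YangMills.Theorems.BalabanUVNodesN15KingModelFreeEnergyMassDerivative
import HarnessLib

/-!
# BalabanUVNodes ∕ N15 — THE KING-MODEL RUNG (PART Ϟ-n): THE PERIODIC FINITE-SIZE CORRECTION TO THE FREE ENERGY DENSITY IS EXPONENTIALLY SMALL —
# `| |T(K)|⁻¹·ln det(c(−Δ)+m²)_{Πℤ∕K_μ} − kingFreeEnergyInf | ≤ B_log·periodConst(κ_F∕2)·e^{−(κ_F∕4)·min_μK_μ}` (Poisson summation of the strip-holomorphic symbol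
# `log(m² + cΣ_μ(2−2cos p_μ))`), HENCE `| |Ω|⁻¹·ln det(c(−Δ_free)+m²)_Ω − kingFreeEnergyInf | ≤ 2B·Σ_μ1∕n_μ + B_log·periodConst·e^{−(κ_F∕2)·min_μn_μ}`: WITH FREE BOUNDARY CONDITIONS
# THE CORRECTION IS A GENUINE SURFACE TERM, WITH PERIODIC ONES IT IS EXPONENTIALLY SMALL
# (Track A, DAG node N15 = NE2; FAN-OUT v1.1 §N15 s3 «KING-MODEL RUNG»; King p.670 l.8–13; count-neutral)

HONEST FRAMING.  Count-neutral (cell `pub-ymgap`, seat `pub-ymgap-dag-n15-e` g41; `--supports stmt-QuantumFields-27366 --as helper` = K3⁸).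
TEMPLATE LITERATURE: C. King, Commun. Math. Phys. **102** (1986) 649–677 [King1986]: (3.89)–(3.93) pp.668–669 (extensive normalisations with volume-uniform control), (4.4)
p.670, §4 p.670 l.8–13; [Balaban1983RegularityDecay] (2.43) p.584 and p.586 l.9–15 (the contour shift); [Balaban1984PropagatorsI] p.36 l.20–23 («relating G on the torus to G
on the whole lattice in the usual way» = Poisson summation).  Part Ε-m proved `|T|⁻¹ln det → kingFreeEnergyInf` qualitatively (Riemann sums); part Ϟ-g bounded free-vs-periodic
by `2BΣ_μ1∕n_μ`.  THIS FILE gives the periodic RATE: the symbol `log(m² + cΣ S1(p_μ))` is STRIP-REGULAR (holomorphic and bounded on the complex strip of half-width `κ_F`, where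
`Re(m² + cΣS1) ≥ m²∕2` keeps it in the slit plane), so its lattice Fourier coefficients decay like `e^{−κ_F|z|_∞}` (pv17 contour shift) and POISSON SUMMATION (pv17
`torusKernel_descend_eq`) turns the dual-torus average into `Σ_{m∈ℤ^{d+1}}ĥ(Km) = ĥ(0) + O(e^{−(κ_F∕4)min K})` with `ĥ(0) = kingFreeEnergyInf`.
§1 (generic) ★ `stripRegular_clog` (a strip-regular-type symbol with `Re ≥ c > 0` and `‖·‖ ≤ C` has a strip-regular LOGARITHM, bound `|ln c| + |ln C| + π`), ★
`norm_tsum_translate_multi_sub_le` (the far images of an exponentially decaying kernel: `‖Σ_mK(w₀+Pm) − K(w₀)‖ ≤ M·periodConst(κ∕2)·e^{−(κ∕4)L}`, Ε-f's argument for a general kernel).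
§2 def **`logSymC c m² p = log(m² + cΣ_μS1(p_μ))`** (complex), `re_freeSymC_ge_half`, `norm_S1_le_six`, `norm_freeSymC_le`, def **`logSymBound c m² d`**, ★★ **`stripRegular_logSymC`**, def
**`logKerC = latticeKernel logSymC`** (the lattice Fourier coefficients `ĥ(z)` of the log-symbol), ★ `norm_logKerC_le`, `logSymC_ofRealVec`, ★ `logKerC_zero_re` (`Re ĥ(0) = kingFreeEnergyInf`).
§3 ★★ **`torusMean_logSymC_eq_tsum`** (POISSON: `(ΠK)⁻¹Σ_{k}log sym(p′_k) = Σ_m ĥ(Km)`), def-free dictionary `finToTor`, `finToTor_bijective`, `cos_dualMomentum_eq_cos_sOf`,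
★ `sum_kingLogSym_dualMomentum_eq` (the `Π Fin K_μ`-indexed dual grid of pv17 = King's `Tor K`-indexed one inside `log lapSym`).
§4 ★★★ **`abs_log_det_lapF_div_card_sub_freeEnergyInf_le`** (`| |T(K)|⁻¹ln det(lapF K c m²) − kingFreeEnergyInf c m² d | ≤ logSymBound·periodConst(κ_F∕2)·e^{−(κ_F∕4)L}` whenever all
`K_μ ≥ L`), ★★★ **`abs_log_det_boxOp_div_card_sub_freeEnergyInf_le`** (the box: `≤ 2(|ln m²|+|ln(m²+4c(d+1))|)Σ_μ1∕n_μ + logSymBound·periodConst(κ_F∕2)·e^{−(κ_F∕4)·2L}`, all `n_μ ≥ L`).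

PRIOR TREE ART (named, USED not restated): Ε-a `…FreeLatticeKernel` (`freeSymC`, `re_freeSymC_ge`, `kappaFree`, `kappaFree_pos`, `kappaFree_sq_bound`, `freeSymC_periodic`,
`differentiable_freeSymC`, `freeSymC_ofRealVec`), Ε-f (`le_two_mul_supNorm_translate`), Ε-k∕Ε-m∕Ε-y (`log_det_lapF`, `kingLogSym`, `kingFreeEnergyInf`, `box_indicator_eq`), Ϟ-e∕Ϟ-g
(`cos_sOf_eq_of_rep`, `card_kingBox`, `abs_log_det_lapF_dbl_div_card_sub_box_le`), pv17 `B4ContourShift` (`StripRegular`, `latticeKernel`, `latticeKernel_decay`, `insertNth_mem_Strip`,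
`openRect_subset_closedRect`, `sides_of_periodic`), `B4TorusKernel` (`MultiPeriod.torusKernel_descend_eq`, `descendC`, `periodise_majorant`, `periodConst`, `summable_of_decay`, `translate`),
`B4TorusGreen244` (`dualMomentum`), `B4StripSums` (`norm_S1_eq`), `B5Strip145Decay` (`differentiableAt_insertNth`), Mathlib (`ContinuousOn.clog`, `DifferentiableOn.clog`, `Complex.log_re∕log_im`,
`abs_arg_le_pi`, `AddCircle.coe_eq_zero_iff`).  NOT Bałaban's covariant objects; NOT a node discharge (N15 is booked through n15-a's knit, untouched); nothing continuum-YM ∕ `ℝ⁴` ∕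
OS ∕ Clay.  0 `sorry`; 3 `def`s (`logSymC`, `logSymBound`, `logKerC`).

HONEST SCOPE.  King's `A = 0` free symbol, `c ≥ 0`, `m² > 0`, every torus `Πℤ∕K_μ` and box `Π{0..n_μ−1}`; the rate constant `κ_F∕4` is pv17's (not optimised); the box statement
compares with the DOUBLED torus through part Ϟ-g.  Locators: [King1986] (3.89)–(3.93) pp.668–669, (4.4) p.670, §4 p.670 l.8–13; [Balaban1983RegularityDecay] (2.43) p.584, p.586
l.9–15; [Balaban1984PropagatorsI] p.36 l.20–23.
-/

noncomputable section

open scoped BigOperators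
open Finset Complex MeasureTheory

namespace Summit.QuantumFields.YangMills.BalabanUVNodes.N15KingModelRung.TorusSpectral

open Literature.MathematicalPhysics.QuantumFieldTheory.Balaban1983to89.B5Prop11Plancherel (Tor sOf)
open Literature.MathematicalPhysics.QuantumFieldTheory.Balaban1983to89.B4Strip (S1 S1r Strip ofRealVec)
open Literature.MathematicalPhysics.QuantumFieldTheory.Balaban1983to89.B4StripSums (norm_S1_eq)
open Literature.MathematicalPhysics.QuantumFieldTheory.Balaban1983to89.B4ContourShift
open Literature.MathematicalPhysics.QuantumFieldTheory.Balaban1983to89.B4TorusKernel (periodConst summable_of_decay rep rep_mem descendC descendC_apply descend)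
open Literature.MathematicalPhysics.QuantumFieldTheory.Balaban1983to89.B4TorusKernel.MultiPeriod (translate translate_apply translate_injective torusKernel torusSum gridPt
  torusKernel_descend_eq torusSupNorm torusSupNorm_nonneg)
open Literature.MathematicalPhysics.QuantumFieldTheory.Balaban1983to89.B4Reflection242 (periodise_majorant)
open Literature.MathematicalPhysics.QuantumFieldTheory.Balaban1983to89.B4TorusGreen244 (dualMomentum)
open Literature.MathematicalPhysics.QuantumFieldTheory.Balaban1983to89.B5Strip145Decay (differentiableAt_insertNth)
open Literature.MathematicalPhysics.QuantumFieldTheory.King1986.Torus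

variable {d : ℕ}

/-! ## §1 Generic: strip-regular logarithms; far images of a decaying kernel -/

section Generic

/-- ★ **A STRIP-REGULAR LOGARITHM**: if `F` is continuous on the closed strip, slice-holomorphic, side-matching, with `Re F ≥ c > 0` and `‖F‖ ≤ C` there, then `log F` (principal branch)
is strip regular with bound `|ln c| + |ln C| + π` (`F` stays in the slit plane). [cite: Balaban1983RegularityDecay, p.586 l.9–15] -/
theorem stripRegular_clog {F : (Fin (d + 1) → ℂ) → ℂ} {κ c C : ℝ} (hκ : 0 ≤ κ) (hc : 0 < c)
    (cont : ContinuousOn F (Strip (d + 1) κ))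
    (diff : ∀ (i : Fin (d + 1)) (q : Fin d → ℝ), q ∈ BZ d → DifferentiableOn ℂ (fun z => F (i.insertNth z (ofRealVec q))) (openRect κ))
    (sides : ∀ (i : Fin (d + 1)) (q : Fin d → ℝ), q ∈ BZ d → ∀ y : ℝ, |y| ≤ κ →
      F (i.insertNth (-Real.pi + y * I) (ofRealVec q)) = F (i.insertNth (Real.pi + y * I) (ofRealVec q)))
    (lowerRe : ∀ p ∈ Strip (d + 1) κ, c ≤ (F p).re) (upper : ∀ p ∈ Strip (d + 1) κ, ‖F p‖ ≤ C) :
    StripRegular (fun p => Complex.log (F p)) κ (|Real.log c| + |Real.log C| + Real.pi) := by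
  have hslit : ∀ p ∈ Strip (d + 1) κ, F p ∈ slitPlane := fun p hp => mem_slitPlane_iff.mpr (Or.inl (lt_of_lt_of_le hc (lowerRe p hp)))
  refine ⟨cont.clog hslit, ?_, ?_, ?_⟩
  · intro i q hq
    exact (diff i q hq).clog fun z hz => hslit _ (insertNth_mem_Strip hκ i hq (openRect_subset_closedRect κ hz))
  · intro i q hq y hy
    show Complex.log _ = Complex.log _
    rw [sides i q hq y hy]
  · intro p hp
    have hre := lowerRe p hp
    have hC := upper p hp
    have hnorm : c ≤ ‖F p‖ := hre.trans (Complex.re_le_norm _)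
    have hpos : 0 < ‖F p‖ := lt_of_lt_of_le hc hnorm
    have h1 : Real.log c ≤ Real.log ‖F p‖ := Real.log_le_log hc hnorm
    have h2 : Real.log ‖F p‖ ≤ Real.log C := Real.log_le_log hpos hC
    have habs : |Real.log ‖F p‖| ≤ |Real.log c| + |Real.log C| := by
      rw [abs_le]
      constructor
      · linarith [neg_abs_le (Real.log c), abs_nonneg (Real.log C)]
      · linarith [le_abs_self (Real.log C), abs_nonneg (Real.log c)]
    calc ‖Complex.log (F p)‖ ≤ |(Complex.log (F p)).re| + |(Complex.log (F p)).im| := norm_le_abs_re_add_abs_im _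
      _ = |Real.log ‖F p‖| + |arg (F p)| := by rw [Complex.log_re, Complex.log_im]
      _ ≤ (|Real.log c| + |Real.log C|) + Real.pi := add_le_add habs (abs_arg_le_pi _)

/-- ★ **THE FAR IMAGES OF A DECAYING KERNEL** (Ε-f's bound for a general kernel): if `‖K(y)‖ ≤ M e^{−κ|y|_∞}` on `ℤ^{d+1}` (`κ > 0`, `M ≥ 0`), then for every period vector `P ≥ L ≥ 1`
(coordinatewise) and every centred `w₀` (`2|w₀,μ| ≤ P_μ`): `‖Σ_{m∈ℤ^{d+1}}K(w₀ + Pm) − K(w₀)‖ ≤ M·periodConst(κ∕2)·e^{−(κ∕4)L}`. [cite: Balaban1984PropagatorsI, p.36 l.20–23, p.38 (1.126)] -/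
theorem norm_tsum_translate_multi_sub_le (K : (Fin (d + 1) → ℤ) → ℂ) {κ M : ℝ} (hκ : 0 < κ) (hM : 0 ≤ M) (hdec : ∀ y, ‖K y‖ ≤ M * Real.exp (-(κ * supNorm y)))
    {P : Fin (d + 1) → ℕ} (hP : ∀ i, 1 ≤ P i) {L : ℕ} (hL : ∀ i, L ≤ P i) {w₀ : Fin (d + 1) → ℤ} (hw : ∀ i, 2 * |w₀ i| ≤ P i) :
    ‖∑' m : Fin (d + 1) → ℤ, K (translate P w₀ m) - K w₀‖ ≤ M * periodConst (κ / 2) d * Real.exp (-(κ / 4 * L)) := by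
  classical
  have hsum : Summable fun m : Fin (d + 1) → ℤ => K (translate P w₀ m) := (summable_of_decay K hκ hdec).comp_injective (translate_injective hP w₀)
  have h0 : translate P w₀ 0 = w₀ := by funext i; simp
  rw [hsum.tsum_eq_add_tsum_ite 0, h0, add_sub_cancel_left]
  obtain ⟨hmaj, hmajle⟩ := periodise_majorant (κ := κ / 2) (M := M) (half_pos hκ) hM hP w₀
  set g : (Fin (d + 1) → ℤ) → ℝ := fun m => Real.exp (-(κ / 4 * L)) * (M * Real.exp (-(κ / 2 * supNorm (translate P w₀ m)))) with hg
  have hgs : Summable g := hmaj.mul_left _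
  have hle : ∀ m : Fin (d + 1) → ℤ, ‖(if m = 0 then 0 else K (translate P w₀ m))‖ ≤ g m := by
    intro m
    simp only [hg]
    by_cases hm0 : m = 0
    · rw [if_pos hm0, norm_zero]; positivity
    · rw [if_neg hm0]
      have hfar : (L : ℝ) ≤ 2 * supNorm (translate P w₀ m) := le_two_mul_supNorm_translate hL hw hm0
      refine le_trans (hdec (translate P w₀ m)) ?_
      rw [show Real.exp (-(κ / 4 * L)) * (M * Real.exp (-(κ / 2 * supNorm (translate P w₀ m))))
          = M * Real.exp (-(κ / 4 * L) + -(κ / 2 * supNorm (translate P w₀ m))) by rw [Real.exp_add]; ring]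
      refine mul_le_mul_of_nonneg_left (Real.exp_le_exp.mpr ?_) hM
      nlinarith [mul_le_mul_of_nonneg_left hfar hκ.le, supNorm_nonneg (translate P w₀ m)]
  have hns : Summable fun m : Fin (d + 1) → ℤ => ‖(if m = 0 then 0 else K (translate P w₀ m))‖ := Summable.of_nonneg_of_le (fun m => norm_nonneg _) hle hgs
  have hPC : 0 ≤ periodConst (κ / 2) d := by
    unfold periodConst
    apply pow_nonneg
    apply div_nonneg (by positivity)
    have : Real.exp (-(κ / 2 / (d + 1))) < 1 := Real.exp_lt_one_iff.mpr (by
      have : 0 < κ / 2 / (d + 1) := by positivity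
      linarith)
    linarith
  calc ‖∑' m : Fin (d + 1) → ℤ, (if m = 0 then 0 else K (translate P w₀ m))‖
      ≤ ∑' m : Fin (d + 1) → ℤ, ‖(if m = 0 then 0 else K (translate P w₀ m))‖ := norm_tsum_le_tsum_norm hns
    _ ≤ ∑' m : Fin (d + 1) → ℤ, g m := Summable.tsum_le_tsum hle hns hgs
    _ = Real.exp (-(κ / 4 * L)) * ∑' m : Fin (d + 1) → ℤ, M * Real.exp (-(κ / 2 * supNorm (translate P w₀ m))) := tsum_mul_left
    _ ≤ Real.exp (-(κ / 4 * L)) * (M * periodConst (κ / 2) d * Real.exp (-(κ / 2 / (d + 1) * torusSupNorm P w₀))) :=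
        mul_le_mul_of_nonneg_left hmajle (Real.exp_pos _).le
    _ ≤ Real.exp (-(κ / 4 * L)) * (M * periodConst (κ / 2) d) := by
        refine mul_le_mul_of_nonneg_left ?_ (Real.exp_pos _).le
        have h1 : Real.exp (-(κ / 2 / (d + 1) * torusSupNorm P w₀)) ≤ 1 := by
          rw [Real.exp_le_one_iff, neg_nonpos]
          exact mul_nonneg (by positivity) (torusSupNorm_nonneg hP w₀)
        calc M * periodConst (κ / 2) d * Real.exp (-(κ / 2 / (d + 1) * torusSupNorm P w₀))
            ≤ M * periodConst (κ / 2) d * 1 := mul_le_mul_of_nonneg_left h1 (mul_nonneg hM hPC)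
          _ = M * periodConst (κ / 2) d := mul_one _
    _ = M * periodConst (κ / 2) d * Real.exp (-(κ / 4 * L)) := by ring

end Generic

/-! ## §2 The log-symbol is strip regular; its lattice Fourier coefficients -/

section LogSymbol

/-- THE COMPLEX LOG-SYMBOL `log(m² + cΣ_μ S1(p_μ))` (principal branch; the symbol has real part `≥ m²∕2` on the strip). [cite: King1986, (4.4) p.670, (3.89) p.668] -/
def logSymC (c m2 : ℝ) (p : Fin (d + 1) → ℂ) : ℂ := Complex.log (freeSymC c m2 p)

/-- THE BOUND `B_log = |ln(m²∕2)| + |ln(m² + 6c(d+1))| + π` of the log-symbol on the strip. [folklore] -/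
def logSymBound (c m2 : ℝ) (d : ℕ) : ℝ := |Real.log (m2 / 2)| + |Real.log (m2 + 6 * c * (d + 1))| + Real.pi

/-- THE LATTICE FOURIER COEFFICIENTS `ĥ(z) = (2π)^{−(d+1)}∫_{[−π,π]^{d+1}} log(m² + cΣ(2−2cos p_μ)) e^{ip·z}dp` of the log-symbol. [cite: Balaban1983RegularityDecay, (2.43) p.584] -/
def logKerC (c m2 : ℝ) (z : Fin (d + 1) → ℤ) : ℂ := latticeKernel (logSymC c m2) z

variable {c m2 : ℝ}

/-- `Re(m² + cΣS1(p_μ)) ≥ m²∕2` on the strip of half-width `κ_F`. [folklore] -/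
theorem re_freeSymC_ge_half (hc : 0 ≤ c) (hm : 0 < m2) {p : Fin (d + 1) → ℂ} (hp : p ∈ Strip (d + 1) (kappaFree c m2 d)) :
    m2 / 2 ≤ (freeSymC c m2 p).re := by
  have hk1 : kappaFree c m2 d ≤ 1 := min_le_left _ _
  have h1 := re_freeSymC_ge m2 hc hk1 hp
  have h2 := kappaFree_sq_bound hc hm d
  linarith

/-- `‖S1(z)‖ ≤ 6` for `|Im z| ≤ 1` (`‖S1 z‖ = 2cosh(Im z) − 2cos(Re z)`, `cosh 1 ≤ 2`). [folklore] -/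
theorem norm_S1_le_six {z : ℂ} (hz : |z.im| ≤ 1) : ‖S1 z‖ ≤ 6 := by
  rw [norm_S1_eq]
  have hcosh : Real.cosh z.im ≤ Real.cosh 1 := by
    rw [Real.cosh_le_cosh, abs_one]; exact hz
  have hcosh1 : Real.cosh 1 ≤ 2 := by
    rw [Real.cosh_eq]
    have h1 := Real.exp_one_lt_d9
    have h2 : Real.exp (-1) ≤ 1 := by rw [Real.exp_le_one_iff]; norm_num
    linarith
  linarith [Real.neg_one_le_cos z.re]

/-- `‖m² + cΣ_μS1(p_μ)‖ ≤ m² + 6c(d+1)` on any strip of half-width `≤ 1` (`c ≥ 0`, `m² > 0`). [folklore] -/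
theorem norm_freeSymC_le (hc : 0 ≤ c) (hm : 0 < m2) {κ : ℝ} (hκ1 : κ ≤ 1) {p : Fin (d + 1) → ℂ} (hp : p ∈ Strip (d + 1) κ) :
    ‖freeSymC c m2 p‖ ≤ m2 + 6 * c * (d + 1) := by
  unfold freeSymC
  calc ‖(m2 : ℂ) + (c : ℂ) * ∑ μ, S1 (p μ)‖ ≤ ‖(m2 : ℂ)‖ + ‖(c : ℂ) * ∑ μ, S1 (p μ)‖ := norm_add_le _ _
    _ ≤ m2 + c * ∑ μ : Fin (d + 1), (6 : ℝ) := by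
        rw [Complex.norm_real, Real.norm_eq_abs, abs_of_pos hm, norm_mul, Complex.norm_real, Real.norm_eq_abs, abs_of_nonneg hc]
        refine add_le_add le_rfl (mul_le_mul_of_nonneg_left ((norm_sum_le _ _).trans (Finset.sum_le_sum fun μ _ => norm_S1_le_six ((hp μ).2.trans hκ1))) hc)
    _ = m2 + 6 * c * (d + 1) := by rw [Finset.sum_const, Finset.card_univ, Fintype.card_fin, nsmul_eq_mul]; push_cast; ring

/-- ★★ **THE LOG-SYMBOL IS STRIP REGULAR**: `log(m² + cΣS1(p_μ))` is continuous on the closed strip of half-width `κ_F(c,m²,d)`, holomorphic in every coordinate slice, `2π`-periodic and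
bounded by `B_log` — the hypotheses of pv17's contour-shift engine. [cite: Balaban1983RegularityDecay, p.586 l.9–15; King1986, (4.4) p.670] -/
theorem stripRegular_logSymC (hc : 0 ≤ c) (hm : 0 < m2) : StripRegular (logSymC (d := d) c m2) (kappaFree c m2 d) (logSymBound c m2 d) := by
  have hκ0 : 0 ≤ kappaFree c m2 d := (kappaFree_pos hc hm d).le
  have hdiff := differentiable_freeSymC (d := d) c m2
  exact stripRegular_clog (F := freeSymC c m2) hκ0 (half_pos hm) hdiff.continuous.continuousOn
    (fun i q _ => (hdiff.comp fun z => differentiableAt_insertNth i (ofRealVec q) z).differentiableOn)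
    (fun i q _ y _ => sides_of_periodic (freeSymC c m2) (fun j p => freeSymC_periodic c m2 j p) i q y)
    (fun p hp => re_freeSymC_ge_half hc hm hp) (fun p hp => norm_freeSymC_le hc hm (min_le_left _ _) hp)

/-- ★ **EXPONENTIAL DECAY OF THE COEFFICIENTS**: `‖ĥ(z)‖ ≤ B_log·e^{−κ_F|z|_∞}`. [cite: Balaban1983RegularityDecay, p.586 l.9–15] -/
theorem norm_logKerC_le (hc : 0 ≤ c) (hm : 0 < m2) (z : Fin (d + 1) → ℤ) : ‖logKerC c m2 z‖ ≤ logSymBound c m2 d * Real.exp (-(kappaFree c m2 d * supNorm z)) :=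
  latticeKernel_decay (stripRegular_logSymC hc hm) (kappaFree_pos hc hm d).le z

/-- `B_log ≥ 0`. [folklore] -/
theorem logSymBound_nonneg (c m2 : ℝ) (d : ℕ) : 0 ≤ logSymBound c m2 d := by unfold logSymBound; positivity

/-- on the real zone the log-symbol is the real number `kingLogSym` (`c ≥ 0`, `m² > 0`). [cite: King1986, (4.4) p.670] -/
theorem logSymC_ofRealVec (hc : 0 ≤ c) (hm : 0 < m2) (p : Fin (d + 1) → ℝ) : logSymC c m2 (ofRealVec p) = ((kingLogSym c m2 p : ℝ) : ℂ) := by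
  unfold logSymC kingLogSym
  rw [freeSymC_ofRealVec, ← Complex.ofReal_log (le_trans hm.le (le_freeSymR c m2 hc p))]
  rfl

/-- ★ **`Re ĥ(0) = kingFreeEnergyInf`** (the zeroth coefficient is the zone average of the real log-symbol; the closed zone `[−π,π]^{d+1}` and Ε-m's half-open one agree a.e.).
[cite: King1986, (3.89) p.668, (4.4) p.670] -/
theorem logKerC_zero_re (hc : 0 ≤ c) (hm : 0 < m2) : (logKerC c m2 (0 : Fin (d + 1) → ℤ)).re = kingFreeEnergyInf c m2 d := by
  have hboxm : MeasurableSet (Set.pi Set.univ fun _ : Fin (d + 1) => Set.Ioc (-Real.pi) Real.pi) := MeasurableSet.univ_pi fun _ => measurableSet_Ioc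
  have hint : ∀ p : Fin (d + 1) → ℝ, integrand (logSymC c m2) 0 p = ((kingLogSym c m2 p : ℝ) : ℂ) := fun p => by
    unfold integrand phase
    rw [logSymC_ofRealVec hc hm]
    simp
  unfold logKerC latticeKernel fourierBox kingFreeEnergyInf
  simp_rw [hint, box_indicator_eq]
  rw [integral_complex_ofReal, Complex.real_smul, Complex.re_ofReal_mul, Complex.ofReal_re, integral_indicator hboxm]
  congr 1
  refine setIntegral_congr_set ?_
  unfold BZ
  exact (Measure.univ_pi_Ioc_ae_eq_Icc (μ := fun _ : Fin (d + 1) => (volume : Measure ℝ))).symm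

end LogSymbol

/-! ## §3 Poisson summation for the dual-torus average of the log-symbol; the dictionary with King's `Tor K` -/

section Poisson

variable {c m2 : ℝ} (K : Fin (d + 1) → ℕ)

/-- ★★ **POISSON SUMMATION**: `(Π_μK_μ)⁻¹Σ_{k∈Π_μℤ∕K_μ} log(m² + cΣS1(p′_{k,μ})) = Σ_{m∈ℤ^{d+1}} ĥ((K_μm_μ)_μ)` (pv17 `torusKernel_descend_eq` at `x = 0`).
[cite: Balaban1984PropagatorsI, p.36 l.20–23; Balaban1983RegularityDecay, (2.43) p.584] -/
theorem torusMean_logSymC_eq_tsum (hc : 0 ≤ c) (hm : 0 < m2) (hK : ∀ i, 1 ≤ K i) :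
    (∏ i, ((K i : ℕ) : ℂ))⁻¹ * ∑ k : (i : Fin (d + 1)) → Fin (K i), logSymC c m2 (ofRealVec (dualMomentum K k))
      = ∑' m : Fin (d + 1) → ℤ, logKerC c m2 (translate K 0 m) := by
  have h := torusKernel_descend_eq (stripRegular_logSymC (d := d) hc hm) (kappaFree_pos hc hm d) hK 0
  unfold torusKernel torusSum at h
  rw [UnitAddTorus.mFourier_zero] at h
  simp only [ContinuousMap.one_apply, mul_one, descendC_apply] at h
  exact h

/-- the `Π Fin K_μ`-indexed dual grid mapped into King's `Tor K = Π ℤ∕K_μ`. [folklore] -/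
def finToTor (k : (i : Fin (d + 1)) → Fin (K i)) : Tor K := fun i => ((k i : ℕ) : ZMod (K i))

/-- `finToTor` is a bijection (`K_μ ≥ 1`). [folklore] -/
theorem finToTor_bijective [hK : ∀ i, NeZero (K i)] : Function.Bijective (finToTor K) := by
  refine (Fintype.bijective_iff_injective_and_card _).mpr ⟨?_, ?_⟩
  · intro k k' h
    funext i
    have hi := congrFun h i
    simp only [finToTor] at hi
    have := (ZMod.natCast_eq_natCast_iff' _ _ _).mp hi
    rw [Nat.mod_eq_of_lt (k i).isLt, Nat.mod_eq_of_lt (k' i).isLt] at this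
    exact Fin.ext this
  · simp [Fintype.card_pi, ZMod.card]

/-- inside `cos` pv17's dual momentum `2π·rep(k_μ∕K_μ)` and King's `p′_μ` of `finToTor k` agree (both are `2πr∕K_μ` for representatives `r ≡ k_μ`). [cite: King1986, (4.1) p.670;
Balaban1984PropagatorsI, (1.29) p.23] -/
theorem cos_dualMomentum_eq_cos_sOf [hK : ∀ i, NeZero (K i)] (k : (i : Fin (d + 1)) → Fin (K i)) (μ : Fin (d + 1)) :
    Real.cos (dualMomentum K k μ) = Real.cos (sOf K (finToTor K k) μ) := by
  have hKr : (0 : ℝ) < K μ := by exact_mod_cast NeZero.pos (K μ)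
  -- `rep(k∕K) = k∕K + z` for an integer `z`
  have hrep : ∃ z : ℤ, rep (gridPt K k μ) = ((k μ : ℕ) : ℝ) / K μ + z := by
    have h1 : ((rep (gridPt K k μ) : ℝ) : UnitAddCircle) = gridPt K k μ := AddCircle.coe_equivIco
    have h2 : gridPt K k μ = ((((k μ : ℕ) : ℝ) / K μ : ℝ) : UnitAddCircle) := rfl
    have h3 : (((rep (gridPt K k μ) - ((k μ : ℕ) : ℝ) / K μ : ℝ)) : UnitAddCircle) = 0 := by
      rw [AddCircle.coe_sub, h1, h2, sub_self]
    obtain ⟨z, hz⟩ := (AddCircle.coe_eq_zero_iff (1 : ℝ)).mp h3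
    refine ⟨z, ?_⟩
    rw [zsmul_eq_mul, mul_one] at hz
    linarith
  obtain ⟨z, hz⟩ := hrep
  rw [cos_sOf_eq_of_rep K (finToTor K k) μ ((k μ : ℕ) : ℤ) (by simp [finToTor])]
  simp only [dualMomentum]
  rw [hz, show 2 * Real.pi * (((k μ : ℕ) : ℝ) / K μ + z) = 2 * Real.pi * (((k μ : ℕ) : ℤ) : ℝ) / K μ + (z : ℤ) * (2 * Real.pi) by push_cast; ring,
    Real.cos_add_int_mul_two_pi]

/-- ★ **THE DICTIONARY**: `Σ_{k∈ΠFin K_μ} kingLogSym(p′_k) = Σ_{q∈Tor K} ln lapSym K (q)` (pv17's and King's dual grids agree inside the even symbol). [cite: King1986, (4.4) p.670;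
Balaban1984PropagatorsI, (1.29) p.23] -/
theorem sum_kingLogSym_dualMomentum_eq [hK : ∀ i, NeZero (K i)] (c m2 : ℝ) :
    ∑ k : (i : Fin (d + 1)) → Fin (K i), kingLogSym c m2 (dualMomentum K k) = ∑ q : Tor K, Real.log (lapSym K c m2 q) := by
  rw [← (Equiv.ofBijective _ (finToTor_bijective K)).sum_comp]
  refine Finset.sum_congr rfl fun k _ => ?_
  unfold kingLogSym lapSym
  simp only [Equiv.ofBijective_apply]
  congr 2
  congr 1
  exact Finset.sum_congr rfl fun μ _ => by rw [cos_dualMomentum_eq_cos_sOf]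

end Poisson

/-! ## §4 The exponential rate on the torus; the box corollary -/

section Rate

variable {c m2 : ℝ}

/-- ★★★ **THE PERIODIC FINITE-SIZE CORRECTION IS EXPONENTIALLY SMALL**: for `c ≥ 0`, `m² > 0` and every torus `Πℤ∕K_μ` with all `K_μ ≥ L ≥ 1`:
`| |T|⁻¹·ln det(c(−Δ)+m²)_T − kingFreeEnergyInf c m² d | ≤ B_log·periodConst(κ_F∕2)·e^{−(κ_F∕4)·L}` (Poisson summation + the contour-shift decay of the coefficients).
[cite: King1986, (3.89)–(3.93) pp.668–669, (4.4) p.670; Balaban1984PropagatorsI, p.36 l.20–23; Balaban1983RegularityDecay, p.586 l.9–15] -/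
theorem abs_log_det_lapF_div_card_sub_freeEnergyInf_le (K : Fin (d + 1) → ℕ) [hK : ∀ i, NeZero (K i)] (hc : 0 ≤ c) (hm : 0 < m2) {L : ℕ} (hL : ∀ i, L ≤ K i) :
    |(Fintype.card (Tor K) : ℝ)⁻¹ * Real.log (lapF K c m2).det - kingFreeEnergyInf c m2 d|
      ≤ logSymBound c m2 d * periodConst (kappaFree c m2 d / 2) d * Real.exp (-(kappaFree c m2 d / 4 * L)) := by
  have hK1 : ∀ i, 1 ≤ K i := fun i => NeZero.one_le
  -- the torus side as the real part of the Poisson left-hand side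
  have hcard : (Fintype.card (Tor K) : ℝ) = ∏ i, (K i : ℝ) := by
    rw [Fintype.card_pi]; push_cast; simp [ZMod.card]
  have hre : (Fintype.card (Tor K) : ℝ)⁻¹ * Real.log (lapF K c m2).det
      = ((∏ i, ((K i : ℕ) : ℂ))⁻¹ * ∑ k : (i : Fin (d + 1)) → Fin (K i), logSymC c m2 (ofRealVec (dualMomentum K k))).re := by
    rw [log_det_lapF K hc hm, ← sum_kingLogSym_dualMomentum_eq K c m2, hcard]
    simp_rw [logSymC_ofRealVec hc hm]
    rw [← Complex.ofReal_sum]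
    have e : (∏ i, ((K i : ℕ) : ℂ))⁻¹ = (((∏ i, (K i : ℝ))⁻¹ : ℝ) : ℂ) := by push_cast; rfl
    rw [e, ← Complex.ofReal_mul, Complex.ofReal_re]
  rw [hre, torusMean_logSymC_eq_tsum K hc hm hK1, ← logKerC_zero_re hc hm, ← Complex.sub_re]
  refine (Complex.abs_re_le_norm _).trans ?_
  have h := norm_tsum_translate_multi_sub_le (logKerC c m2) (kappaFree_pos hc hm d) (logSymBound_nonneg c m2 d) (norm_logKerC_le hc hm) hK1 hL
    (w₀ := 0) (fun i => by simp)
  simpa using h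

/-- ★★★ **ON THE BOX: THE FREE-BOUNDARY CORRECTION IS A SURFACE TERM** — for `c ≥ 0`, `m² > 0`, every box `Ω = Π_μ{0,…,n_μ−1}` with all `n_μ ≥ L ≥ 1`:
`| |Ω|⁻¹·ln det(c(−Δ_free)+m²)_Ω − kingFreeEnergyInf c m² d | ≤ 2(|ln m²| + |ln(m²+4c(d+1))|)·Σ_μ(n_μ)⁻¹ + B_log·periodConst(κ_F∕2)·e^{−(κ_F∕4)·2L}` (part Ϟ-g against the doubled
torus, whose own correction is exponentially small). [cite: King1986, (3.89)–(3.93) pp.668–669, §4 p.670 l.8–13, (4.4) p.670] -/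
theorem abs_log_det_boxOp_div_card_sub_freeEnergyInf_le (n : Fin (d + 1) → ℕ) [hn : ∀ μ, NeZero (n μ)] (hc : 0 ≤ c) (hm : 0 < m2) {L : ℕ} (hL : ∀ i, L ≤ n i) :
    |(Fintype.card (KingBox n) : ℝ)⁻¹ * Real.log (boxOp n c m2).det - kingFreeEnergyInf c m2 d|
      ≤ 2 * (|Real.log m2| + |Real.log (m2 + 4 * c * (d + 1))|) * ∑ μ, ((n μ : ℝ))⁻¹
        + logSymBound c m2 d * periodConst (kappaFree c m2 d / 2) d * Real.exp (-(kappaFree c m2 d / 4 * ((2 * L : ℕ) : ℝ))) := by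
  have h1 := abs_log_det_lapF_dbl_div_card_sub_box_le n hc hm
  have h2 := abs_log_det_lapF_div_card_sub_freeEnergyInf_le (dblPer n) hc hm (L := 2 * L) (fun i => by simp only [dblPer]; exact Nat.mul_le_mul_left 2 (hL i))
  calc |(Fintype.card (KingBox n) : ℝ)⁻¹ * Real.log (boxOp n c m2).det - kingFreeEnergyInf c m2 d|
      ≤ |(Fintype.card (KingBox n) : ℝ)⁻¹ * Real.log (boxOp n c m2).det - (Fintype.card (Tor (dblPer n)) : ℝ)⁻¹ * Real.log (lapF (dblPer n) c m2).det|
          + |(Fintype.card (Tor (dblPer n)) : ℝ)⁻¹ * Real.log (lapF (dblPer n) c m2).det - kingFreeEnergyInf c m2 d| := abs_sub_le _ _ _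
    _ ≤ _ := add_le_add (by rw [abs_sub_comm]; exact h1) h2

end Rate

end Summit.QuantumFields.YangMills.BalabanUVNodes.N15KingModelRung.TorusSpectral

end
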